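import Summits.Ventures.YMGap.Thresholds.HessianPlaquette
import HarnessLib

/-!
# Venture YMGap — THEOREM C (kernel form): `Σ_p h_p(Q,X) ≤ 4d |X|²`, hypothesis-free

HONEST FRAMING: venture file (cell `pub-ymgap`, track (a), A2 = "Theorem C" of `p2/HESSIAN-SHARP.md`,
referee-checked in the cell). This file ASSEMBLES the kernel-checked bricks (`HessianPlaquette`:
per-plaquette SPL bound and transport identity; `LatticeBochner`: Cor. 1) into

  `H_Q(X,X) := Σ_{p : Plaquette d L} h_p(Q,X) ≤ 4d · |X|²`   (`hessianTotal_le_four_d'`)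

on the torus `(ℤ/Lℤ)^d`, for link variables `Q_e ∈ M_N(ℂ)` with `Q_eᴴQ_e = 1` and anti-Hermitian
directions `X_e`, with NO further hypothesis (the unitary diagonalisability of the plaquette holonomies
is the tree's `Literature.LinearAlgebra.Matrix.exists_unitary_diagonalization`). `h_p` is HESSIAN-SHARP
(0.1) by definition (T2.1, its identification with `∂²_t Re tr(e^{tX}Q)_p`, is not formalised), so
this is «Λ_d(N) ≤ 4d» at the level of the quadratic form; the SZZ window `1/(8d)` needs in addition
the product-group Bakry–Émery theorem (T2.2, a named printed fact). No threshold is claimed here.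
Proof (HESSIAN-SHARP §3): `Σ_p (2Σ_{e∈p}|X_e|² - γ_p) = 4(d-1)|X|² - Σ_p γ_p ≤ 4(d-1)|X|² + 4|X|²`.

References: `p2/HESSIAN-SHARP.md` §3; `p2/LEAN-TARGETS-A2.md` T1.4; `HOME/lean/A2-PORT-SCOPE.md`.
-/

noncomputable section

namespace Summit.Ventures.YMGap.HessianSharp

open ComplexConjugate Complex Matrix Finset
open Literature.MathematicalPhysics.QuantumFieldTheory (Site Edge Plaquette)

variable {N d L : ℕ}

/-! ### Symmetry of the corner form and sums over plaquettes -/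

section Sums

variable [NeZero L]

omit [NeZero L] in
/-- `γ_{(x;μ,ν)} = γ_{(x;ν,μ)}`. -/
theorem gammaCorner_symm (Q X : Edge d L → Matrix (Fin N) (Fin N) ℂ) (x : Site d L) (μ ν : Fin d) :
    gammaCorner Q X x μ ν = gammaCorner Q X x ν μ := by
  simp only [gammaCorner, xPlus]
  rw [add_right_comm x (unitVec ν) (unitVec μ), ip_comm (X (x, ν)) (X (x, μ)),
    ip_comm (xMinus Q X (x + unitVec μ + unitVec ν) μ),
    ip_comm (xMinus Q X (x + unitVec ν) ν) (X (x + unitVec ν, μ)),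
    ip_comm (xMinus Q X (x + unitVec μ) μ) (X (x + unitVec μ, ν))]
  ring

/-- **Ordered pairs versus plaquette orientations**: for a symmetric `g`,
`Σ_{μ<ν} g(μ,ν) = ½ Σ_μ Σ_ν [μ ≠ ν] g(μ,ν)`. -/
private theorem sum_lt_eq_half_sum_ne (g : Fin d → Fin d → ℝ) (hg : ∀ μ ν, g μ ν = g ν μ) :
    ∑ q : {q : Fin d × Fin d // q.1 < q.2}, g q.1.1 q.1.2 =
      (1 / 2) * ∑ μ, ∑ ν, (if μ = ν then 0 else g μ ν) := by
  classical
  -- over the product type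
  have hprod : ∑ μ, ∑ ν, (if μ = ν then (0 : ℝ) else g μ ν) =
      ∑ q : Fin d × Fin d, (if q.1 = q.2 then (0 : ℝ) else g q.1 q.2) :=
    (Fintype.sum_prod_type' (fun μ ν => if μ = ν then (0 : ℝ) else g μ ν)).symm
  -- pointwise trichotomy split
  have hsplit : ∀ q : Fin d × Fin d, (if q.1 = q.2 then (0 : ℝ) else g q.1 q.2) =
      (if q.1 < q.2 then g q.1 q.2 else 0) + (if q.2 < q.1 then g q.1 q.2 else 0) := fun q => by
    rcases lt_trichotomy q.1 q.2 with h | h | h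
    · simp [h, h.ne, not_lt.2 h.le]
    · simp [h]
    · simp [h, h.ne', not_lt.2 h.le]
  have hswap : ∑ q : Fin d × Fin d, (if q.2 < q.1 then g q.1 q.2 else 0) =
      ∑ q : Fin d × Fin d, (if q.1 < q.2 then g q.1 q.2 else 0) := by
    rw [← Equiv.sum_comp (Equiv.prodComm (Fin d) (Fin d))]
    refine Finset.sum_congr rfl fun q _ => ?_
    simp only [Equiv.prodComm_apply, Prod.fst_swap, Prod.snd_swap, hg q.2 q.1]
  have hsub : ∑ q : {q : Fin d × Fin d // q.1 < q.2}, g q.1.1 q.1.2 =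
      ∑ q : Fin d × Fin d, (if q.1 < q.2 then g q.1 q.2 else 0) := by
    rw [← Finset.sum_filter, Finset.sum_subtype (Finset.univ.filter fun q : Fin d × Fin d => q.1 < q.2)
      (p := fun q : Fin d × Fin d => q.1 < q.2) (fun q => by simp)]
  rw [hprod, Finset.sum_congr rfl fun q _ => hsplit q, Finset.sum_add_distrib, hswap, hsub]
  ring

/-- **Cor. 1 over the tree's plaquettes**: `Σ_{p : Plaquette d L} γ_p ≥ -4|X|²`. -/
theorem sum_plaquette_gammaCorner_ge (Q X : Edge d L → Matrix (Fin N) (Fin N) ℂ)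
    (hQ : ∀ e, (Q e)ᴴ * Q e = 1) :
    -(4 * fieldNormSq X) ≤ ∑ p : Plaquette d L, gammaCorner Q X p.1 p.2.1.1 p.2.1.2 := by
  rw [Fintype.sum_prod_type]
  have h : ∀ x : Site d L, ∑ q : {q : Fin d × Fin d // q.1 < q.2}, gammaCorner Q X x q.1.1 q.1.2 =
      (1 / 2) * ∑ μ, ∑ ν, (if μ = ν then 0 else gammaCorner Q X x μ ν) := fun x =>
    sum_lt_eq_half_sum_ne _ (gammaCorner_symm Q X x)
  simp only [h, ← Finset.mul_sum]
  exact half_sum_gammaCorner_ge Q X hQ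

/-- **The edge count**: `Σ_{p : Plaquette d L} Σ_{e ∈ p} |X_e|² = 2(d-1)|X|²` (every edge lies in
`2(d-1)` plaquettes). -/
theorem sum_plaquette_nsq (X : Edge d L → Matrix (Fin N) (Fin N) ℂ) :
    ∑ p : Plaquette d L, (nsq (X (p.1, p.2.1.1)) + nsq (X (link2 p.1 p.2.1.1 p.2.1.2)) +
        nsq (X (link3 p.1 p.2.1.1 p.2.1.2)) + nsq (X (p.1, p.2.1.2))) =
      2 * ((d : ℝ) - 1) * fieldNormSq X := by
  -- A_μ := Σ_x |X_(x,μ)|²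
  set A : Fin d → ℝ := fun μ => ∑ x : Site d L, nsq (X (x, μ)) with hA
  have hAsum : ∑ μ, A μ = fieldNormSq X := by
    simp only [hA, fieldNormSq]
    rw [Fintype.sum_prod_type, Finset.sum_comm]
  rw [Fintype.sum_prod_type]
  -- per site, symmetrise over orientations
  have hsym : ∀ x : Site d L, ∑ q : {q : Fin d × Fin d // q.1 < q.2},
      (nsq (X (x, q.1.1)) + nsq (X (link2 x q.1.1 q.1.2)) + nsq (X (link3 x q.1.1 q.1.2)) +
        nsq (X (x, q.1.2))) =
      (1 / 2) * ∑ μ, ∑ ν, (if μ = ν then 0 else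
        (nsq (X (x, μ)) + nsq (X (link2 x μ ν)) + nsq (X (link3 x μ ν)) + nsq (X (x, ν)))) :=
    fun x => sum_lt_eq_half_sum_ne
      (fun μ ν => nsq (X (x, μ)) + nsq (X (link2 x μ ν)) + nsq (X (link3 x μ ν)) + nsq (X (x, ν)))
      fun μ ν => by simp only [link2, link3]; ring
  simp only [hsym, ← Finset.mul_sum]
  -- exchange Σ_x with Σ_μ Σ_ν and re-index the shifted terms
  rw [Finset.sum_comm]
  have hx : ∀ μ, ∑ x : Site d L, ∑ ν, (if μ = ν then (0:ℝ) else
      (nsq (X (x, μ)) + nsq (X (link2 x μ ν)) + nsq (X (link3 x μ ν)) + nsq (X (x, ν)))) =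
      ∑ ν, (if μ = ν then (0:ℝ) else 2 * (A μ + A ν)) := fun μ => by
    rw [Finset.sum_comm]
    refine Finset.sum_congr rfl fun ν _ => ?_
    split_ifs with h
    · simp
    · have h2 : ∑ x : Site d L, nsq (X (link2 x μ ν)) = A ν :=
        Fintype.sum_equiv (Equiv.addRight (unitVec μ)) _ _ fun x => rfl
      have h3 : ∑ x : Site d L, nsq (X (link3 x μ ν)) = A μ :=
        Fintype.sum_equiv (Equiv.addRight (unitVec ν)) _ _ fun x => rfl
      simp only [Finset.sum_add_distrib, h2, h3, hA]
      ring
  simp only [hx]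
  -- Σ_μ Σ_ν [μ≠ν] 2(A_μ + A_ν) = 4(d-1) Σ_μ A_μ
  have hne : ∀ μ, ∑ ν, (if μ = ν then (0:ℝ) else 2 * (A μ + A ν)) =
      ∑ ν, 2 * (A μ + A ν) - 4 * A μ := fun μ => by
    have : ∑ ν, 2 * (A μ + A ν) = ∑ ν, (if μ = ν then (0:ℝ) else 2 * (A μ + A ν)) +
        ∑ ν, (if μ = ν then 2 * (A μ + A ν) else 0) := by
      rw [← Finset.sum_add_distrib]
      refine Finset.sum_congr rfl fun ν _ => ?_
      split_ifs <;> simp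
    rw [this, Finset.sum_ite_eq Finset.univ μ, if_pos (Finset.mem_univ μ)]
    ring
  have hS : ∀ μ, ∑ ν : Fin d, 2 * (A μ + A ν) = 2 * (d : ℝ) * A μ + 2 * ∑ ν, A ν := fun μ => by
    simp only [mul_add, Finset.sum_add_distrib, Finset.sum_const, Finset.card_univ, Fintype.card_fin,
      ← Finset.mul_sum]
    ring
  simp only [hne, hS, Finset.sum_sub_distrib, Finset.sum_add_distrib, ← Finset.mul_sum,
    Finset.sum_const, Finset.card_univ, Fintype.card_fin, hAsum]
  ring

end Sums

/-! ### Theorem C -/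

section Assembly

variable [NeZero L]

/-- `H_Q(X,X) = Σ_{p : Plaquette d L} h_p(Q,X)` — the Hessian form of the Wilson action summed over
the plaquettes of the torus (HESSIAN-SHARP §0). -/
def hessianTotal (Q X : Edge d L → Matrix (Fin N) (Fin N) ℂ) : ℝ :=
  ∑ p : Plaquette d L, hessForm Q X p.1 p.2.1.1 p.2.1.2

/-- **THEOREM C (kernel form): `H_Q(X,X) ≤ 4d |X|²`** for every unitary link field `Q` and every
anti-Hermitian direction field `X` on `(ℤ/Lℤ)^d`, provided every plaquette holonomy is unitarily
diagonalisable (true for all unitary matrices; named hypothesis, see `UnitarilyDiagonalizable`).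
HESSIAN-SHARP §3: SPL per plaquette + the transport identity + the edge count `2(d-1)` + Cor. 1. -/
theorem hessianTotal_le_four_d (Q X : Edge d L → Matrix (Fin N) (Fin N) ℂ)
    (hQ : ∀ e, (Q e)ᴴ * Q e = 1) (hX : ∀ e, (X e)ᴴ = -X e)
    (hW : ∀ (x : Site d L) (μ ν : Fin d), μ < ν → UnitarilyDiagonalizable (hol Q x μ ν)) :
    hessianTotal Q X ≤ 4 * (d : ℝ) * fieldNormSq X := by
  -- per plaquette: h_p ≤ 2 Σ_{e∈p}|X_e|² - γ_p
  have hp : ∀ p : Plaquette d L, hessForm Q X p.1 p.2.1.1 p.2.1.2 ≤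
      2 * (nsq (X (p.1, p.2.1.1)) + nsq (X (link2 p.1 p.2.1.1 p.2.1.2)) +
        nsq (X (link3 p.1 p.2.1.1 p.2.1.2)) + nsq (X (p.1, p.2.1.2))) -
      gammaCorner Q X p.1 p.2.1.1 p.2.1.2 := fun p => by
    have h1 := hessForm_add_gammaTilde_le Q X hQ hX p.1 p.2.1.1 p.2.1.2 (hW _ _ _ p.2.2)
    have h2 := gammaTilde_eq_gammaCorner Q X hQ hX p.1 p.2.1.1 p.2.1.2
    linarith
  have hsum := Finset.sum_le_sum fun p (_ : p ∈ (Finset.univ : Finset (Plaquette d L))) => hp p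
  rw [Finset.sum_sub_distrib, ← Finset.mul_sum, sum_plaquette_nsq] at hsum
  have hγ := sum_plaquette_gammaCorner_ge Q X hQ
  unfold hessianTotal
  linarith

/-- **THEOREM C (kernel form, hypothesis-free): `H_Q(X,X) ≤ 4d |X|²`** for every unitary link
field and every anti-Hermitian direction field on `(ℤ/Lℤ)^d` — the plaquette holonomies are unitary
(`hol_unitary`), hence unitarily diagonalisable by the spectral theorem for unitary matrices
(`Literature.LinearAlgebra.Matrix.exists_unitary_diagonalization`). -/
theorem hessianTotal_le_four_d' (Q X : Edge d L → Matrix (Fin N) (Fin N) ℂ)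
    (hQ : ∀ e, (Q e)ᴴ * Q e = 1) (hX : ∀ e, (X e)ᴴ = -X e) :
    hessianTotal Q X ≤ 4 * (d : ℝ) * fieldNormSq X :=
  hessianTotal_le_four_d Q X hQ hX fun x μ ν _ =>
    Literature.LinearAlgebra.Matrix.exists_unitary_diagonalization _ (hol_unitary Q hQ x μ ν)

end Assembly

end Summit.Ventures.YMGap.HessianSharp
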